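import Literature.AnabelianGeometry.SemiGraphs.PSCThreeChainOrigin
import HarnessLib

/-!
# [CombGC] Prop. 1.2 (i), unramified case, at STURDY three-component chain data; all rows at every chain origin

Mochizuki, *A combinatorial version of the Grothendieck conjecture* [CombGC] §1, Prop. 1.2 (i) p. 8,
unramified case ("under the further assumption that `G` is sturdy, if `B₁ ∩ B₂` is open in `B₁`, then
`v₁ = v₂`", `Bᵢ` the images in `Π^unr_G`) [cite: MochizukiCombGC2007, Prop 1.2(i) p.8]; Prop. 1.5 (ii)
p. 13, Thm. 1.6 (i) p. 13 [cite: MochizukiCombGC2007, Prop 1.5(ii) p.13] [cite: MochizukiCombGC2007, Thm 1.6(i) p.13].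
PROOF-ONLY file (abc-iut-f-164 gen 3; abc-iut FACT-LIST rows F-0459 `OpenInterDeterminesComponentHolds`,
F-0443 `GraphicIffEdgeLikeVerticialHolds`, F-0458 `NumericallyCuspidalIffHolds`), sequel of
`PSCThreeChainOrigin.lean`, whose conclusions for F-0459 / F-0443 / F-0458 were restricted to chain origins
with a component of genus `< 2` (unramified clause vacuous).  Here the unramified clause is PROVED at
STURDY chains by abc-iut-f-164 gen 2's handle-character method (`PSCTwoComponentAffineShapeEdges.lean`):
for `v ≠ w` the continuous extension to `ℤ/ℓⁿ` of the handle character `a_{i_v} ↦ 1` (`i_v` a handle of the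
component `v`: `0`, `g₀`, `g₁`; every other generator `↦ 0`) kills every cusp group and both node loops
(each the product of a cusp window and a commutator window), hence `Ker(Π_G ↠ Π^unr_G)` (abc-iut-f-165's
`unrKer_le_ker`), and every generator of `Π_w`, while it is `1` on `γ₁ι(a_{i_v})γ₁⁻¹`; conclude by the
profinite pigeonhole `not_isOpen_inf_subgroupOf_of_characters`.

* `unrVerticialOpenInterDeterminesVertex_of_threeChain` — the unramified clause at every chain datum
  (ANY genera: for non-sturdy data the clause is vacuous, for sturdy data the handle characters);
* `threeChainOrigin_rows'` — at EVERY origin of three-component chain data (genera recorded, no genus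
  bound): **F-0459** (all three clauses), **F-0443** (Prop. 1.5 (ii), abc-iut-w4-d081's reduction) and, for
  `Σ = {l}`, **F-0458** (Thm. 1.6 (i));
* `exists_threeChainOrigin_holds'` — the origin of ALL three-component chain data with `Σ = {l}` (inhabited
  for every splitting, including the STURDY chain over `Γ_{6,6}` with genera `(2,2,2)`):
  OpenInterDeterminesComponentHolds ∧ EdgeLikeIncidenceHolds ∧ GraphicIffEdgeLikeVerticialHolds ∧
  CuspidalEdgeLikeCharacterizationHolds ∧ NumericallyCuspidalIffHolds, and the first clause of F-0438
  datum-wise (the sturdy `Π^unr` commensurable-terminality clause of Prop. 1.2 (ii) stays open).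

Instance forms at data of the shape of genuine three-component curves: consistency evidence for the typed
schemata, not the printed theorems for all pointed stable curves.  0 definitions; nothing here takes a side
on [IUTchIII] Cor. 3.12.
-/

noncomputable section

namespace Literature.AnabelianGeometry.SemiGraphs

open scoped Pointwise
open Literature.GroupTheory.CombinatorialGroupTheory
open SemiGraphOfAnabelioids (IsProSigmaCompletion)
open Multiplicative

universe u

namespace PSCDatum

open TwoComponentAffine

variable {P : Type u} [Group P] [TopologicalSpace P] [IsTopologicalGroup P]
variable [CompactSpace P] [T2Space P] [TotallyDisconnectedSpace P] {Sigma : Set ℕ} {g r : ℕ}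

omit [T2Space P] in
/-- **[CombGC] Prop. 1.2 (i), unramified case, at every three-component chain datum** (sturdy case by handle
characters; see the module docstring). [cite: MochizukiCombGC2007, Prop 1.2(i) p.8] -/
theorem unrVerticialOpenInterDeterminesVertex_of_threeChain (hne : Sigma.Nonempty)
    (hprime : ∀ p ∈ Sigma, p.Prime) (ι : PuncturedSurfaceGroup g r →* P)
    (hι : IsProSigmaCompletion Sigma ι) (G : PSCDatum P) {g₀ g₁ s₁ s₂ : ℕ} (hg : g₀ ≤ g₁) (hg₁ : g₁ ≤ g)
    (e : G.graph.C ≃ Fin r)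
    (hC : ∀ c, G.cuspGp c =
      ((PuncturedSurfaceGroup.cuspInertia (g := g) (e c)).map ι).topologicalClosure)
    (v₀ vm v₁ : G.graph.V) (hV : ∀ w, w = v₀ ∨ w = vm ∨ w = v₁) (εA η : PuncturedSurfaceGroup g r)
    (hεA : εA = ((List.finRange r).map fun j : Fin r =>
          if s₂ ≤ (j : ℕ) then PuncturedSurfaceGroup.c (g := g) j else 1).prod *
        ((List.finRange g).map fun i : Fin g => if (i : ℕ) < g₀ then
          PuncturedSurfaceGroup.a (r := r) i * PuncturedSurfaceGroup.b i *
            (PuncturedSurfaceGroup.a i)⁻¹ * (PuncturedSurfaceGroup.b i)⁻¹ else 1).prod)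
    (hη : η = ((List.finRange r).map fun j : Fin r =>
          if s₁ ≤ (j : ℕ) then PuncturedSurfaceGroup.c (g := g) j else 1).prod *
        ((List.finRange g).map fun i : Fin g => if (i : ℕ) < g₁ then
          PuncturedSurfaceGroup.a (r := r) i * PuncturedSurfaceGroup.b i *
            (PuncturedSurfaceGroup.a i)⁻¹ * (PuncturedSurfaceGroup.b i)⁻¹ else 1).prod)
    (hV₀ : G.vertGp v₀ = ((Subgroup.closure {x : PuncturedSurfaceGroup g r |
        (∃ i : Fin g, (i : ℕ) < g₀ ∧ (x = PuncturedSurfaceGroup.a i ∨ x = PuncturedSurfaceGroup.b i)) ∨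
        ∃ j : Fin r, s₂ ≤ (j : ℕ) ∧ x = PuncturedSurfaceGroup.c j}).map ι).topologicalClosure)
    (hVm : G.vertGp vm = ((Subgroup.closure {x : PuncturedSurfaceGroup g r |
        (∃ i : Fin g, (g₀ ≤ (i : ℕ) ∧ (i : ℕ) < g₁) ∧
          (x = PuncturedSurfaceGroup.a i ∨ x = PuncturedSurfaceGroup.b i)) ∨
        (∃ j : Fin r, (s₁ ≤ (j : ℕ) ∧ (j : ℕ) < s₂) ∧ x = PuncturedSurfaceGroup.c j) ∨
        x = εA ∨ x = η}).map ι).topologicalClosure)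
    (hV₁ : G.vertGp v₁ = ((Subgroup.closure {x : PuncturedSurfaceGroup g r |
        (∃ i : Fin g, g₁ ≤ (i : ℕ) ∧ (x = PuncturedSurfaceGroup.a i ∨ x = PuncturedSurfaceGroup.b i)) ∨
        (∃ j : Fin r, (j : ℕ) < s₁ ∧ x = PuncturedSurfaceGroup.c j) ∨ x = η}).map ι).topologicalClosure)
    (nA nB : G.graph.N) (hN : ∀ n, n = nA ∨ n = nB)
    (hEA : G.nodeGp nA = ((Subgroup.zpowers εA).map ι).topologicalClosure)
    (hEB : G.nodeGp nB = ((Subgroup.zpowers η).map ι).topologicalClosure)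
    (hgen₀ : G.genus v₀ = g₀) (hgenm : G.genus vm = g₁ - g₀) (hgen₁ : G.genus v₁ = g - g₁) :
    G.UnrVerticialOpenInterDeterminesVertex := by
  classical
  obtain ⟨ℓ, hℓS⟩ := hne
  have hℓ : ℓ.Prime := hprime ℓ hℓS
  intro hst v w γ₁ γ₂ hopen
  by_contra hvw
  have h0 : 2 ≤ g₀ := hgen₀ ▸ hst v₀
  have hm : 2 ≤ g₁ - g₀ := hgenm ▸ hst vm
  have h1 : 2 ≤ g - g₁ := hgen₁ ▸ hst v₁
  -- a handle character (all cusps `↦ 0`) kills both node loops, every cusp group, hence `unrKer`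
  have hunr : ∀ {n : ℕ} (φ : PuncturedSurfaceGroup g r →* Multiplicative (ZMod n)),
      (∀ k, φ (PuncturedSurfaceGroup.c k) = ofAdd ((0 : Fin r → ZMod n) k)) →
      ∀ χ : P →* Multiplicative (ZMod n), Continuous χ → (∀ γ, χ (ι γ) = φ γ) →
        φ εA = 1 ∧ φ η = 1 ∧ G.unrKer ≤ χ.ker := by
    intro n φ hφc χ hχc hχ
    have hφA : φ εA = 1 := by rw [hεA, character_nodeLoop φ hφc]; simp
    have hφB : φ η = 1 := by rw [hη, character_nodeLoop φ hφc]; simp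
    refine ⟨hφA, hφB, G.unrKer_le_ker χ hχc (fun c => ?_) (fun n' => ?_)⟩
    · rw [hC, PuncturedSurfaceGroup.cuspInertia]
      exact topologicalClosure_map_zpowers_le_ker ι χ hχc _ (by rw [hχ, hφc]; rfl)
    · rcases hN n' with rfl | rfl
      · rw [hEA]; exact topologicalClosure_map_zpowers_le_ker ι χ hχc _ (by rw [hχ, hφA])
      · rw [hEB]; exact topologicalClosure_map_zpowers_le_ker ι χ hχc _ (by rw [hχ, hφB])
  -- the handle character at `i` kills `Π_w` as soon as `i` is not a handle of `w`
  have hkill : ∀ (w : G.graph.V) (i : Fin g),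
      ((w = v₀ ∧ g₀ ≤ (i : ℕ)) ∨ (w = vm ∧ ((i : ℕ) < g₀ ∨ g₁ ≤ (i : ℕ))) ∨ (w = v₁ ∧ (i : ℕ) < g₁)) →
      ∀ {n : ℕ} (φ : PuncturedSurfaceGroup g r →* Multiplicative (ZMod n))
        (χ : P →* Multiplicative (ZMod n)), Continuous χ → (∀ γ, χ (ι γ) = φ γ) →
        (∀ i', φ (PuncturedSurfaceGroup.a i') = ofAdd (if i' = i then (1 : ZMod n) else 0)) →
        (∀ i', φ (PuncturedSurfaceGroup.b i') = ofAdd ((0 : Fin g → ZMod n) i')) →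
        (∀ k, φ (PuncturedSurfaceGroup.c k) = ofAdd ((0 : Fin r → ZMod n) k)) →
        G.vertGp w ≤ χ.ker := by
    intro w i hw n φ χ hχc hχ hφa hφb hφc
    obtain ⟨hφA, hφB, -⟩ := hunr φ hφc χ hχc hχ
    have ha' : ∀ i' : Fin g, i' ≠ i → χ (ι (PuncturedSurfaceGroup.a i')) = 1 := fun i' hi' => by
      rw [hχ, hφa, if_neg hi']; rfl
    have hb' : ∀ i' : Fin g, χ (ι (PuncturedSurfaceGroup.b i')) = 1 := fun i' => by rw [hχ, hφb]; rfl
    have hc' : ∀ k : Fin r, χ (ι (PuncturedSurfaceGroup.c k)) = 1 := fun k => by rw [hχ, hφc]; rfl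
    rcases hw with ⟨rfl, hi⟩ | ⟨rfl, hi⟩ | ⟨rfl, hi⟩
    · rw [hV₀]
      refine topologicalClosure_map_closure_le_ker ι χ hχc _ ?_
      rintro y (⟨i', hi', rfl | rfl⟩ | ⟨j, -, rfl⟩)
      · exact ha' i' (fun h => by subst h; omega)
      · exact hb' i'
      · exact hc' j
    · rw [hVm]
      refine topologicalClosure_map_closure_le_ker ι χ hχc _ ?_
      rintro y (⟨i', hi', rfl | rfl⟩ | ⟨j, -, rfl⟩ | rfl | rfl)
      · exact ha' i' (fun h => by subst h; omega)
      · exact hb' i'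
      · exact hc' j
      · rw [hχ, hφA]
      · rw [hχ, hφB]
    · rw [hV₁]
      refine topologicalClosure_map_closure_le_ker ι χ hχc _ ?_
      rintro y (⟨i', hi', rfl | rfl⟩ | ⟨j, -, rfl⟩ | rfl)
      · exact ha' i' (fun h => by subst h; omega)
      · exact hb' i'
      · exact hc' j
      · rw [hχ, hφB]
  -- the engine: a handle `a_i ∈ Π_v` that is not a handle of `w`
  have main : ∀ (i : Fin g), ι (PuncturedSurfaceGroup.a i) ∈ G.vertGp v →
      ((w = v₀ ∧ g₀ ≤ (i : ℕ)) ∨ (w = vm ∧ ((i : ℕ) < g₀ ∨ g₁ ≤ (i : ℕ))) ∨ (w = v₁ ∧ (i : ℕ) < g₁)) →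
      False := by
    intro i hiv hiw
    refine not_isOpen_inf_subgroupOf_of_characters hℓ.one_lt (γ₁ • G.vertGp v ⊔ G.unrKer)
      (γ₂ • G.vertGp w ⊔ G.unrKer) (x := γ₁ • ι (PuncturedSurfaceGroup.a i))
      (Subgroup.mem_sup_left (Subgroup.smul_mem_pointwise_smul _ _ _ hiv)) (fun m => ?_) hopen
    let wa : Fin g → ZMod (ℓ ^ m) := fun i' => if i' = i then 1 else 0
    obtain ⟨φ, hφa, hφb, hφc⟩ :=
      PuncturedSurfaceGroup.exists_handleCuspCharacter (r := r) wa 0 0 (by simp)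
    obtain ⟨χ, hχc, hχ⟩ := exists_continuous_extend_zmod_pow hι hℓ hℓS m φ
    obtain ⟨-, -, hK⟩ := hunr φ hφc χ hχc hχ
    refine ⟨χ, sup_le (smul_le_ker_of_le_ker (hkill w i hiw φ χ hχc hχ hφa hφb hφc) γ₂) hK, ?_⟩
    rw [map_conjAct_smul_eq_self, hχ, hφa]
    simp [wa]
  have ha₀ : ι (PuncturedSurfaceGroup.a (r := r) (⟨0, by omega⟩ : Fin g)) ∈ G.vertGp v₀ := by
    rw [hV₀]
    exact Subgroup.le_topologicalClosure _ (Subgroup.mem_map_of_mem ι (Subgroup.subset_closure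
      (Or.inl ⟨_, by change 0 < g₀; omega, Or.inl rfl⟩)))
  have ham : ι (PuncturedSurfaceGroup.a (r := r) (⟨g₀, by omega⟩ : Fin g)) ∈ G.vertGp vm := by
    rw [hVm]
    exact Subgroup.le_topologicalClosure _ (Subgroup.mem_map_of_mem ι (Subgroup.subset_closure
      (Or.inl ⟨_, ⟨by change g₀ ≤ g₀; exact le_rfl, by change g₀ < g₁; omega⟩, Or.inl rfl⟩)))
  have ha₁ : ι (PuncturedSurfaceGroup.a (r := r) (⟨g₁, by omega⟩ : Fin g)) ∈ G.vertGp v₁ := by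
    rw [hV₁]
    exact Subgroup.le_topologicalClosure _ (Subgroup.mem_map_of_mem ι (Subgroup.subset_closure
      (Or.inl ⟨_, by change g₁ ≤ g₁; exact le_rfl, Or.inl rfl⟩)))
  rcases hV v with rfl | rfl | rfl <;> rcases hV w with hw | hw | hw
  · exact hvw hw.symm
  · exact main ⟨0, by omega⟩ ha₀ (Or.inr (Or.inl ⟨hw, Or.inl (by change 0 < g₀; omega)⟩))
  · exact main ⟨0, by omega⟩ ha₀ (Or.inr (Or.inr ⟨hw, by change 0 < g₁; omega⟩))
  · exact main ⟨g₀, by omega⟩ ham (Or.inl ⟨hw, by change g₀ ≤ g₀; exact le_rfl⟩)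
  · exact hvw hw.symm
  · exact main ⟨g₀, by omega⟩ ham (Or.inr (Or.inr ⟨hw, by change g₀ < g₁; omega⟩))
  · exact main ⟨g₁, by omega⟩ ha₁ (Or.inl ⟨hw, by change g₀ ≤ g₁; exact hg⟩)
  · exact main ⟨g₁, by omega⟩ ha₁ (Or.inr (Or.inl ⟨hw, Or.inr (by change g₁ ≤ g₁; exact le_rfl)⟩))
  · exact hvw hw.symm

/-! ### All rows at every origin of three-component chain data (genera recorded) -/

/-- **F-0459, F-0443 and (for `Σ = {l}`) F-0458 at EVERY origin of three-component chain data** (genera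
recorded; no genus bound): [CombGC] Prop. 1.2 (i) in all three clauses (the unramified one by
`unrVerticialOpenInterDeterminesVertex_of_threeChain`), Prop. 1.5 (ii) by abc-iut-w4-d081's reduction, Thm.
1.6 (i) by abc-iut-f-164 gen 0's reduction — together with F-0440, F-1931 and the first clause of F-0438
from `threeChainOrigin_rows`. [cite: MochizukiCombGC2007, Prop 1.2(i) p.8]
[cite: MochizukiCombGC2007, Prop 1.5(ii) p.13] [cite: MochizukiCombGC2007, Thm 1.6(i) p.13] -/
theorem threeChainOrigin_rows' (Ω : PSCOrigin.{u})
    (hΩ : ∀ ⦃Q : Type u⦄ [Group Q] [TopologicalSpace Q] (G : PSCDatum Q),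
      Ω.IsOfPSCType G → ∃ (_ : IsTopologicalGroup Q), CompactSpace Q ∧ T2Space Q ∧
        TotallyDisconnectedSpace Q ∧
        ∃ (S : Set ℕ) (g r g₀ g₁ s₁ s₂ : ℕ) (ι : PuncturedSurfaceGroup g r →* Q) (e : G.graph.C ≃ Fin r)
          (v₀ vm v₁ : G.graph.V) (nA nB : G.graph.N) (εA η : PuncturedSurfaceGroup g r),
          S.Nonempty ∧ (∀ p ∈ S, p.Prime) ∧ IsProSigmaCompletion S ι ∧ g₀ ≤ g₁ ∧ g₁ ≤ g ∧ 2 ≤ s₁ ∧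
          s₁ + 2 ≤ s₂ ∧ s₂ + 2 ≤ r ∧
          (∀ c, G.cuspGp c =
            ((PuncturedSurfaceGroup.cuspInertia (g := g) (e c)).map ι).topologicalClosure) ∧
          (∀ w, w = v₀ ∨ w = vm ∨ w = v₁) ∧ (∀ n, n = nA ∨ n = nB) ∧
          εA = ((List.finRange r).map fun j : Fin r =>
              if s₂ ≤ (j : ℕ) then PuncturedSurfaceGroup.c (g := g) j else 1).prod *
            ((List.finRange g).map fun i : Fin g => if (i : ℕ) < g₀ then
              PuncturedSurfaceGroup.a (r := r) i * PuncturedSurfaceGroup.b i *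
                (PuncturedSurfaceGroup.a i)⁻¹ * (PuncturedSurfaceGroup.b i)⁻¹ else 1).prod ∧
          η = ((List.finRange r).map fun j : Fin r =>
              if s₁ ≤ (j : ℕ) then PuncturedSurfaceGroup.c (g := g) j else 1).prod *
            ((List.finRange g).map fun i : Fin g => if (i : ℕ) < g₁ then
              PuncturedSurfaceGroup.a (r := r) i * PuncturedSurfaceGroup.b i *
                (PuncturedSurfaceGroup.a i)⁻¹ * (PuncturedSurfaceGroup.b i)⁻¹ else 1).prod ∧
          G.vertGp v₀ = ((Subgroup.closure {x : PuncturedSurfaceGroup g r |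
            (∃ i : Fin g, (i : ℕ) < g₀ ∧ (x = PuncturedSurfaceGroup.a i ∨ x = PuncturedSurfaceGroup.b i)) ∨
            ∃ j : Fin r, s₂ ≤ (j : ℕ) ∧ x = PuncturedSurfaceGroup.c j}).map ι).topologicalClosure ∧
          G.vertGp vm = ((Subgroup.closure {x : PuncturedSurfaceGroup g r |
            (∃ i : Fin g, (g₀ ≤ (i : ℕ) ∧ (i : ℕ) < g₁) ∧
              (x = PuncturedSurfaceGroup.a i ∨ x = PuncturedSurfaceGroup.b i)) ∨
            (∃ j : Fin r, (s₁ ≤ (j : ℕ) ∧ (j : ℕ) < s₂) ∧ x = PuncturedSurfaceGroup.c j) ∨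
            x = εA ∨ x = η}).map ι).topologicalClosure ∧
          G.vertGp v₁ = ((Subgroup.closure {x : PuncturedSurfaceGroup g r |
            (∃ i : Fin g, g₁ ≤ (i : ℕ) ∧ (x = PuncturedSurfaceGroup.a i ∨ x = PuncturedSurfaceGroup.b i)) ∨
            (∃ j : Fin r, (j : ℕ) < s₁ ∧ x = PuncturedSurfaceGroup.c j) ∨ x = η}).map ι).topologicalClosure ∧
          G.nodeGp nA = ((Subgroup.zpowers εA).map ι).topologicalClosure ∧
          G.nodeGp nB = ((Subgroup.zpowers η).map ι).topologicalClosure ∧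
          G.graph.nodeEnds nA = s(v₀, vm) ∧ G.graph.nodeEnds nB = s(vm, v₁) ∧
          G.genus v₀ = g₀ ∧ G.genus vm = g₁ - g₀ ∧ G.genus v₁ = g - g₁) :
    OpenInterDeterminesComponentHolds Ω ∧ EdgeLikeIncidenceHolds Ω ∧ GraphicIffEdgeLikeVerticialHolds Ω ∧
      CuspidalEdgeLikeCharacterizationHolds Ω ∧
      (∀ ⦃Q : Type u⦄ [Group Q] [TopologicalSpace Q] [IsTopologicalGroup Q] (G : PSCDatum Q),
        Ω.IsOfPSCType G → G.VerticialEdgeLikeCommensurablyTerminal) ∧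
      ∀ l : ℕ, (∀ ⦃Q : Type u⦄ [Group Q] [TopologicalSpace Q] [IsTopologicalGroup Q] (G : PSCDatum Q),
        Ω.IsOfPSCType G → G.Sigma = {l}) → NumericallyCuspidalIffHolds Ω := by
  -- the genus-free part from `threeChainOrigin_rows`
  obtain ⟨h15i, hdatum, hchar, -⟩ := threeChainOrigin_rows Ω (fun Q _ _ G hG => by
    obtain ⟨hTG, hc, ht, hd, S, g, r, g₀, g₁, s₁, s₂, ι, e, v₀, vm, v₁, nA, nB, εA, η, hne, hprime, hι, hg,
      -, hs₁, hs₁₂, hs₂, hC, hV, hN, hεA, hη, hV₀, hVm, hV₁, hEA, hEB, hendsA, hendsB, -⟩ := hΩ G hG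
    exact ⟨hTG, hc, ht, hd, S, g, r, g₀, g₁, s₁, s₂, ι, e, v₀, vm, v₁, nA, nB, εA, η, hne, hprime, hι, hg,
      hs₁, hs₁₂, hs₂, hC, hV, hN, hεA, hη, hV₀, hVm, hV₁, hEA, hEB, hendsA, hendsB⟩)
  have h12i : OpenInterDeterminesComponentHolds Ω := fun Q _ _ _ G hG => by
    obtain ⟨h1, h2, -⟩ := hdatum G hG
    obtain ⟨_, hcQ, -, hdQ, S, g, r, g₀, g₁, s₁, s₂, ι, e, v₀, vm, v₁, nA, nB, εA, η, hne, hprime, hι, hg,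
      hg₁, -, -, -, hC, hV, hN, hεA, hη, hV₀, hVm, hV₁, hEA, hEB, -, -, hgen₀, hgenm, hgen₁⟩ := hΩ G hG
    haveI := hcQ
    haveI := hdQ
    exact ⟨h1, h2, G.unrVerticialOpenInterDeterminesVertex_of_threeChain hne hprime ι hι hg hg₁ e hC v₀
      vm v₁ hV εA η hεA hη hV₀ hVm hV₁ nA nB hN hEA hEB hgen₀ hgenm hgen₁⟩
  have hbr : ∀ ⦃Q : Type u⦄ [Group Q] [TopologicalSpace Q] [IsTopologicalGroup Q] (G : PSCDatum Q),
      Ω.IsOfPSCType G → ∀ n : G.graph.N, ∃ (w₁ w₂ : G.graph.V) (γ₁ γ₂ : ConjAct Q),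
        G.graph.nodeEnds n = s(w₁, w₂) ∧ γ₁ • G.nodeGp n ≤ G.vertGp w₁ ∧
          γ₂ • G.nodeGp n ≤ G.vertGp w₂ ∧ γ₁⁻¹ • G.vertGp w₁ ≠ γ₂⁻¹ • G.vertGp w₂ := by
    intro Q _ _ _ G hG
    obtain ⟨_, hcQ, htQ, hdQ, S, g, r, g₀, g₁, s₁, s₂, ι, e, v₀, vm, v₁, nA, nB, εA, η, hne, hprime, hι,
      hg, -, hs₁, hs₁₂, hs₂, hC, hV, hN, hεA, hη, hV₀, hVm, hV₁, hEA, hEB, hendsA, hendsB, -⟩ := hΩ G hG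
    haveI := hcQ
    haveI := htQ
    haveI := hdQ
    exact (G.threeChain_rows hne hprime ι hι hg hs₁ hs₁₂ hs₂ e hC v₀ vm v₁ hV εA η hεA hη hV₀ hVm hV₁ nA
      nB hN hEA hEB hendsA hendsB).2.2.2.2
  refine ⟨h12i, h15i, graphicIffEdgeLikeVerticialHolds_of_incidence Ω h12i h15i hbr, hchar,
    fun Q _ _ _ G hG => (hdatum G hG).2.2, fun l hSig => ?_⟩
  exact numericallyCuspidalIffHolds_of_characterization Ω l
    (fun Q _ _ _ G hG => by
      obtain ⟨_, hc, -, hd, -⟩ := hΩ G hG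
      exact ⟨hc, hd⟩) hSig h12i hchar

/-- **At the origin of ALL three-component chain data with `Σ = {l}`** — inhabited for every splitting
`g₀ ≤ g₁ ≤ g`, `2 ≤ s₁`, `s₁ + 2 ≤ s₂`, `s₂ + 2 ≤ r`, in particular by the STURDY chain with genera
`(2, 2, 2)` over `Γ_{6,6}` — F-0459 ([CombGC] Prop. 1.2 (i), all clauses), F-0440 (Prop. 1.5 (i)), F-0443
(Prop. 1.5 (ii)), F-1931 ([IUTchI] Rmk. 1.2.3 (iv), cuspidal) and F-0458 (Thm. 1.6 (i)) HOLD, and the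
verticial/edge-like clause of F-0438 holds at every datum.  [cite: MochizukiCombGC2007, Prop 1.5(ii) p.13]
[cite: MochizukiCombGC2007, Prop 1.2(i) p.8] [cite: MochizukiCombGC2007, Thm 1.6(i) p.13] -/
theorem exists_threeChainOrigin_holds' (l : ℕ) (hl : l.Prime) :
    ∃ Ω : PSCOrigin.{0},
      (∀ g r g₀ g₁ s₁ s₂ : ℕ, g₀ ≤ g₁ → g₁ ≤ g → 2 ≤ s₁ → s₁ + 2 ≤ s₂ → s₂ + 2 ≤ r →
        ∃ (Q : ProfiniteGrp.{0}) (ι : PuncturedSurfaceGroup g r →* Q) (G : PSCDatum Q),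
          IsProSigmaCompletion {l} ι ∧ Ω.IsOfPSCType G ∧ G.Sigma = {l} ∧ G.graph.i = 3 ∧ G.graph.n = 2 ∧
            G.graph.r = r ∧ ∃ v₀ vm v₁ : G.graph.V, (∀ w, w = v₀ ∨ w = vm ∨ w = v₁) ∧
              G.genus v₀ = g₀ ∧ G.genus vm = g₁ - g₀ ∧ G.genus v₁ = g - g₁) ∧
      (∃ (Q : ProfiniteGrp.{0}) (G : PSCDatum Q), Ω.IsOfPSCType G ∧ G.IsSturdy ∧ G.graph.i = 3 ∧
        G.graph.n = 2) ∧
      OpenInterDeterminesComponentHolds Ω ∧ EdgeLikeIncidenceHolds Ω ∧ GraphicIffEdgeLikeVerticialHolds Ω ∧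
      CuspidalEdgeLikeCharacterizationHolds Ω ∧ NumericallyCuspidalIffHolds Ω ∧
      ∀ ⦃Q : Type⦄ [Group Q] [TopologicalSpace Q] [IsTopologicalGroup Q] (G : PSCDatum Q),
        Ω.IsOfPSCType G → G.VerticialEdgeLikeCommensurablyTerminal := by
  classical
  let Ω : PSCOrigin.{0} :=
    ⟨fun {Q} _ _ G => G.Sigma = {l} ∧ ∃ (_ : IsTopologicalGroup Q),
      CompactSpace Q ∧ T2Space Q ∧ TotallyDisconnectedSpace Q ∧
      ∃ (S : Set ℕ) (g r g₀ g₁ s₁ s₂ : ℕ) (ι : PuncturedSurfaceGroup g r →* Q) (e : G.graph.C ≃ Fin r)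
        (v₀ vm v₁ : G.graph.V) (nA nB : G.graph.N) (εA η : PuncturedSurfaceGroup g r),
        S.Nonempty ∧ (∀ p ∈ S, p.Prime) ∧ IsProSigmaCompletion S ι ∧ g₀ ≤ g₁ ∧ g₁ ≤ g ∧ 2 ≤ s₁ ∧
        s₁ + 2 ≤ s₂ ∧ s₂ + 2 ≤ r ∧
        (∀ c, G.cuspGp c =
          ((PuncturedSurfaceGroup.cuspInertia (g := g) (e c)).map ι).topologicalClosure) ∧
        (∀ w, w = v₀ ∨ w = vm ∨ w = v₁) ∧ (∀ n, n = nA ∨ n = nB) ∧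
        εA = ((List.finRange r).map fun j : Fin r =>
            if s₂ ≤ (j : ℕ) then PuncturedSurfaceGroup.c (g := g) j else 1).prod *
          ((List.finRange g).map fun i : Fin g => if (i : ℕ) < g₀ then
            PuncturedSurfaceGroup.a (r := r) i * PuncturedSurfaceGroup.b i *
              (PuncturedSurfaceGroup.a i)⁻¹ * (PuncturedSurfaceGroup.b i)⁻¹ else 1).prod ∧
        η = ((List.finRange r).map fun j : Fin r =>
            if s₁ ≤ (j : ℕ) then PuncturedSurfaceGroup.c (g := g) j else 1).prod *
          ((List.finRange g).map fun i : Fin g => if (i : ℕ) < g₁ then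
            PuncturedSurfaceGroup.a (r := r) i * PuncturedSurfaceGroup.b i *
              (PuncturedSurfaceGroup.a i)⁻¹ * (PuncturedSurfaceGroup.b i)⁻¹ else 1).prod ∧
        G.vertGp v₀ = ((Subgroup.closure {x : PuncturedSurfaceGroup g r |
          (∃ i : Fin g, (i : ℕ) < g₀ ∧ (x = PuncturedSurfaceGroup.a i ∨ x = PuncturedSurfaceGroup.b i)) ∨
          ∃ j : Fin r, s₂ ≤ (j : ℕ) ∧ x = PuncturedSurfaceGroup.c j}).map ι).topologicalClosure ∧
        G.vertGp vm = ((Subgroup.closure {x : PuncturedSurfaceGroup g r |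
          (∃ i : Fin g, (g₀ ≤ (i : ℕ) ∧ (i : ℕ) < g₁) ∧
            (x = PuncturedSurfaceGroup.a i ∨ x = PuncturedSurfaceGroup.b i)) ∨
          (∃ j : Fin r, (s₁ ≤ (j : ℕ) ∧ (j : ℕ) < s₂) ∧ x = PuncturedSurfaceGroup.c j) ∨
          x = εA ∨ x = η}).map ι).topologicalClosure ∧
        G.vertGp v₁ = ((Subgroup.closure {x : PuncturedSurfaceGroup g r |
          (∃ i : Fin g, g₁ ≤ (i : ℕ) ∧ (x = PuncturedSurfaceGroup.a i ∨ x = PuncturedSurfaceGroup.b i)) ∨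
          (∃ j : Fin r, (j : ℕ) < s₁ ∧ x = PuncturedSurfaceGroup.c j) ∨ x = η}).map ι).topologicalClosure ∧
        G.nodeGp nA = ((Subgroup.zpowers εA).map ι).topologicalClosure ∧
        G.nodeGp nB = ((Subgroup.zpowers η).map ι).topologicalClosure ∧
        G.graph.nodeEnds nA = s(v₀, vm) ∧ G.graph.nodeEnds nB = s(vm, v₁) ∧
        G.genus v₀ = g₀ ∧ G.genus vm = g₁ - g₀ ∧ G.genus v₁ = g - g₁⟩
  have hl' : ∀ p ∈ ({l} : Set ℕ), p.Prime := fun p hp => by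
    rw [Set.mem_singleton_iff.mp hp]; exact hl
  obtain ⟨h12i, h15i, h15ii, hchar, h12ii, h16i⟩ := threeChainOrigin_rows' Ω (fun Q _ _ G hG => hG.2)
  have hmem : ∀ g r g₀ g₁ s₁ s₂ : ℕ, g₀ ≤ g₁ → g₁ ≤ g → 2 ≤ s₁ → s₁ + 2 ≤ s₂ → s₂ + 2 ≤ r →
      ∃ (Q : ProfiniteGrp.{0}) (ι : PuncturedSurfaceGroup g r →* Q) (G : PSCDatum Q),
        IsProSigmaCompletion {l} ι ∧ Ω.IsOfPSCType G ∧ G.Sigma = {l} ∧ G.graph.i = 3 ∧ G.graph.n = 2 ∧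
          G.graph.r = r ∧ ∃ v₀ vm v₁ : G.graph.V, (∀ w, w = v₀ ∨ w = vm ∨ w = v₁) ∧
            G.genus v₀ = g₀ ∧ G.genus vm = g₁ - g₀ ∧ G.genus v₁ = g - g₁ := by
    intro g r g₀ g₁ s₁ s₂ hg hg₁ hs₁ hs₁₂ hs₂
    obtain ⟨Q, ι, G, e, v₀, vm, v₁, nA, nB, εA, η, hι, hS, hi, hn, hr, hC, hV, hN, hεA, hη, hV₀, hVm, hV₁,
      hEA, hEB, hgen₀, hgenm, hgen₁, hendsA, hendsB⟩ :=
      exists_threeChainDatum {l} ⟨l, rfl⟩ hl' g r g₀ g₁ s₁ s₂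
    exact ⟨Q, ι, G, hι, ⟨hS, inferInstance, inferInstance, inferInstance, inferInstance, {l}, g, r, g₀, g₁,
      s₁, s₂, ι, e, v₀, vm, v₁, nA, nB, εA, η, ⟨l, rfl⟩, hl', hι, hg, hg₁, hs₁, hs₁₂, hs₂, hC, hV, hN, hεA,
      hη, hV₀, hVm, hV₁, hEA, hEB, hendsA, hendsB, hgen₀, hgenm, hgen₁⟩, hS, hi, hn, hr, v₀, vm, v₁, hV,
      hgen₀, hgenm, hgen₁⟩
  refine ⟨Ω, hmem, ?_, h12i, h15i, h15ii, hchar, h16i l (fun Q _ _ _ G hG => hG.1), h12ii⟩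
  obtain ⟨Q, ι, G, -, hG, -, hi, hn, -, v₀, vm, v₁, hV, hg₀, hgm, hg₁⟩ :=
    hmem 6 6 2 4 2 4 (by norm_num) (by norm_num) le_rfl le_rfl le_rfl
  refine ⟨Q, G, hG, fun v => ?_, hi, hn⟩
  rcases hV v with rfl | rfl | rfl
  · rw [hg₀]
  · rw [hgm]
  · rw [hg₁]

end PSCDatum

end Literature.AnabelianGeometry.SemiGraphs

end
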